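import Literature.IUT.LogVolume.GenuineSupportPrimesBound
import Literature.IUT.LogVolume.Theorem110GenuineStepIIPinned
import Literature.IUT.LogVolume.GenuineLogThetaPointGalois
import Literature.IUT.LogVolume.DistinguishedPrimesBoundTower
import HarnessLib

/-!
# [IUTchIV] Thm. 1.10 Step (iii) AT A GENUINE Θ-VOLUME DATUM — every hypothesis discharged (reading v3)

Mochizuki, *Inter-universal Teichmüller theory IV*, RIMS manuscript (Apr. 2020; = PRIMS **57** (2021)), Thm. 1.10 proof
Step (iii) pp. 25–26 ("`log(𝔰^ℚ) ≤ 2·d_mod·(log(𝔡^{F_tpd}) + log(𝔣^{F_tpd})) + log(2·3·5·l)`"), with (D0) p. 24 ("if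
`v ∈ 𝕍(F_tpd)^non` does not divide `2·3·5·l` and … is not contained in `Supp(𝔮^{F_tpd}_ADiv)`, then the extension `K/F_tpd`
is unramified over `v`" — "follows immediately from Proposition 1.8, (vi), (vii)"). TAKES NO SIDE on [IUTchIII] Cor. 3.12.

`GenuineSupportPrimesBound.lean` (abc-iut-S3) proved the Step (iii) bound for the support primes `T(I)` of a genuine
Θ-volume datum `T` at `(P, l)` MODULO the (D0)-descent `hD0` of ramified places of `K` prime to `2·3·5·l`. THIS FILE
discharges `hD0` for EVERY datum of the cell's reading v3 (`Cor22.ThetaVolumeDatumAt`, `F` pinned by `IsSubThetaField`,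
`E` with `j(E) = j(λ)`, `D` initial Θ-data) from the tree's instance forms of Prop. 1.8 (vi)(vii):
* `K/F` unramified at good places `∤ l`: abc-iut-S-d1 `ramificationIdx_eq_one_of_ker_le` over the embedding
  `K → F̄ ≅ AlgebraicClosure F` pinned by `ker_galoisRepTorsion_le_fixingSubgroup_of_initialThetaData`;
* `F/F_tpd` unramified at good places `∤ 30`: abc-iut-S-d1 `ramificationIdx_subThetaField_eq_one`;
* the descent along `F_tpd ⊆ F ⊆ K`: abc-iut-L5-t15 `ramified_place_descends_of_not_dvd`;
* the Galois facts: abc-iut-S2 `ThetaVolumeDatumAt.isGalois_tpd` / `isGalois_F_K`.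
Result: `Cor22.ThetaVolumeDatumAt.sum_log_supportPrimes_le_pinned (T) (hP : P ∈ UP) :
Σ_{q ∈ T(I)} log q ≤ 2·d_mod·(log-diff(λ) + log 𝔣^{∤{2,l}}(λ)) + log(2·3·5·l)` — the `(iii)` input of the route's
layer-2 tower junction with NO hypothesis beyond `λ ∈ U_X`. [cite: Mochizuki2012, IUTchIV Thm. 1.10 proof Step (iii)
p. 25–26] [claim: Mochizuki2012, status: disputed] for every IUT quotation. Classical; nothing bears on Cor. 3.12.
-/

noncomputable section

open scoped Classical

namespace Literature.IUT.LogVolume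

namespace Cor22

namespace ThetaVolumeDatumAt

open NumberField IsDedekindDomain Literature.IUT.HodgeTheaters
open Literature.NumberTheory.DiophantineGeometry.GenEll

variable {P : NFPoint} {l : ℕ} (T : ThetaVolumeDatumAt P l)

/-- **The (D0)-descent at the datum, discharged**: every place `u` of `K = T.K` ramified over `ℚ` with residue
characteristic prime to `2·3·5·l` lies over a place of `F_tpd` that is bad away from `{2, l}` or itself ramified over `ℚ`
— Prop. 1.8 (vi)(vii) for `F_tpd ⊆ F ⊆ K` (abc-iut-S-d1's instance forms) pushed through abc-iut-L5-t15's descent.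
[cite: Mochizuki2012, IUTchIV Thm. 1.10 proof Step (iii) (D0) p. 24–25] [claim: Mochizuki2012, status: disputed] -/
theorem ramified_descends_pinned (hP : P ∈ UP) :
    letI := T.instFieldF; letI := T.instNumberFieldF; letI := T.instAlgebraF; letI := T.instFieldK
    letI := T.instNumberFieldK; letI := T.instAlgebraK
    ∀ u : HeightOneSpectrum (𝓞 T.K), 2 ≤ u.asIdeal.ramificationIdx ℤ → ¬ residueChar T.K u ∣ 2 * 3 * 5 * l →
      finBelow P.F T.F (finBelow T.F T.K u) ∈ badPlacesAvoid P {2, l} ∨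
        2 ≤ (finBelow P.F T.F (finBelow T.F T.K u)).asIdeal.ramificationIdx ℤ := by
  letI := T.instFieldF; letI := T.instNumberFieldF; letI := T.instAlgebraF; letI := T.instFieldK
  letI := T.instNumberFieldK; letI := T.instAlgebraK; letI := T.instFieldFbar; letI := T.instAlgebraFbar
  letI := T.instAlgebraKFbar; letI := T.instIsElliptic
  have hU : P.InU := hP.1
  have hl : l.Prime := T.D.l_prime
  haveI := T.D.isScalarTower
  haveI := T.D.isAlgClosure
  haveI : IsGalois P.F T.F := T.isGalois_tpd
  haveI : IsGalois T.F T.K := T.isGalois_F_K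
  -- the composite algebra `F_tpd → F → K`
  letI : Algebra P.F T.K := ((algebraMap T.F T.K).comp (algebraMap P.F T.F)).toAlgebra
  haveI : IsScalarTower P.F T.F T.K := IsScalarTower.of_algebraMap_eq fun _ => rfl
  have hfb : ∀ u : HeightOneSpectrum (𝓞 T.K), finBelow P.F T.F (finBelow T.F T.K u) = finBelow P.F T.K u :=
    fun u => finBelow_finBelow P.F T.F T.K u
  -- the embedding `K → AlgebraicClosure F` inside the `l`-division field
  let ι : T.Fbar ≃ₐ[T.F] AlgebraicClosure T.F := IsAlgClosure.equiv T.F T.Fbar (AlgebraicClosure T.F)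
  let ψ : T.K →ₐ[T.F] AlgebraicClosure T.F :=
    (ι : T.Fbar →ₐ[T.F] AlgebraicClosure T.F).comp (IsScalarTower.toAlgHom T.F T.K T.Fbar)
  have hK : (T.E.galoisRepTorsion (l : ℤ)).ker ≤ ψ.fieldRange.fixingSubgroup :=
    ker_galoisRepTorsion_le_fixingSubgroup_of_initialThetaData T.D ι
  have hss : T.E.IsSemistable (𝓞 T.F) := T.D.isSemistable
  -- bad places away from `{2, l}` vs bad places, for residue characteristics `∉ {2, l}`
  have hS : ∀ p ∈ ({2, l} : Finset ℕ), p.Prime := by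
    intro p hp
    simp only [Finset.mem_insert, Finset.mem_singleton] at hp
    rcases hp with rfl | rfl
    · exact Nat.prime_two
    · exact hl
  have avoid_of_bad : ∀ v : HeightOneSpectrum (𝓞 P.F), v ∈ badPlaces P → residueChar P.F v ≠ 2 →
      residueChar P.F v ≠ l → v ∈ badPlacesAvoid P {2, l} := by
    intro v hv h2 hl'
    refine mem_badPlacesAvoid_of_residueChar_notMem hS hv ?_
    simp only [Finset.mem_insert, Finset.mem_singleton, not_or]
    exact ⟨h2, hl'⟩
  -- (D0), `K`-layer: unramified at good places of residue characteristic `∉ {2,3,5,l}`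
  have hKunr : ∀ u : HeightOneSpectrum (𝓞 T.K), residueChar T.K u ∉ ({2, 3, 5, l} : Finset ℕ) →
      finBelow P.F T.K u ∉ badPlacesAvoid P {2, l} → u.asIdeal.ramificationIdx (𝓞 T.F) = 1 := by
    intro u hp hSu
    simp only [Finset.mem_insert, Finset.mem_singleton, not_or] at hp
    refine ramificationIdx_eq_one_of_ker_le ψ hss T.j_eq hK u
      (natCast_notMem_finBelow_of_residueChar_ne hl u hp.2.2.2) fun hb => hSu ?_
    rw [hfb u] at hb
    have hres : residueChar P.F (finBelow P.F T.K u) = residueChar T.K u := residueChar_finBelow (F := P.F) u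
    exact avoid_of_bad _ hb (by rw [hres]; exact hp.1) (by rw [hres]; exact hp.2.2.2)
  -- (D0), `F`-layer: unramified at good places of residue characteristic `∉ {2,3,5,l}`
  have hFunr : ∀ w : HeightOneSpectrum (𝓞 T.F), residueChar T.F w ∉ ({2, 3, 5, l} : Finset ℕ) →
      finBelow P.F T.F w ∉ badPlacesAvoid P {2, l} → w.asIdeal.ramificationIdx (𝓞 P.F) = 1 := by
    intro w hp hSw
    simp only [Finset.mem_insert, Finset.mem_singleton, not_or] at hp
    have h30 : residueChar T.F w ∉ ({2, 3, 5} : Finset ℕ) := by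
      simp only [Finset.mem_insert, Finset.mem_singleton, not_or]; exact ⟨hp.1, hp.2.1, hp.2.2.1⟩
    refine ramificationIdx_subThetaField_eq_one T.F hU T.isSubThetaField w
      (thirty_notMem_finBelow_of_residueChar_notMem w h30) fun hb => hSw ?_
    have hres : residueChar P.F (finBelow P.F T.F w) = residueChar T.F w := residueChar_finBelow (F := P.F) w
    exact avoid_of_bad _ hb (by rw [hres]; exact hp.1) (by rw [hres]; exact hp.2.2.2)
  intro u hram hndvd
  rw [hfb u]
  exact ramified_place_descends_of_not_dvd P.F T.F T.K (badPlacesAvoid P {2, l}) hKunr hFunr u hram hndvd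

/-- **[IUTchIV] Thm. 1.10 Step (iii) at a genuine Θ-volume datum, unconditionally**: for every datum `T` at `(P, l)`
with `λ ∈ U_X` (minimally presented), `Σ_{q ∈ T(I)} log q ≤ 2·d_mod·(log-diff(λ) + log 𝔣^{∤{2,l}}(λ)) + log(2·3·5·l)` —
`sum_log_supportPrimes_le` with its (D0) input discharged by `ramified_descends_pinned`.
[cite: Mochizuki2012, IUTchIV Thm. 1.10 proof Step (iii) p. 26] [claim: Mochizuki2012, status: disputed] -/
theorem sum_log_supportPrimes_le_pinned (hP : P ∈ UP) :
    (letI := T.instFieldF; letI := T.instNumberFieldF; letI := T.instFieldK; letI := T.instNumberFieldK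
     letI := T.instAlgebraK
     ∑ q ∈ T.I.supportPrimes, Real.log (q : ℝ)) ≤
      2 * (dmod P : ℝ) * (P.logDiff + logCondAvoid P {2, l}) + Real.log (2 * 3 * 5 * (l : ℝ)) := by
  letI := T.instFieldF; letI := T.instNumberFieldF; letI := T.instAlgebraF; letI := T.instFieldK
  letI := T.instNumberFieldK; letI := T.instAlgebraK; letI := T.instFieldFbar; letI := T.instAlgebraFbar
  letI := T.instAlgebraKFbar; letI := T.instIsElliptic
  exact T.sum_log_supportPrimes_le hP T.D.l_prime.pos (T.ramified_descends_pinned hP)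

end ThetaVolumeDatumAt

end Cor22

end Literature.IUT.LogVolume

end
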